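import Literature.NumberTheory.LFunctions.TuringMethodTrudgianII
import Literature.NumberTheory.LFunctions.TuringMethodTrudgianNumerics
import Literature.NumberTheory.LFunctions.BookerLemmaProofs
import HarnessLib

/-!
# Turing's method II: the lower bound, the certified numerics, and Trudgian's Theorem 1 reduced to
# its two explicit inputs

Sequel to `TuringMethodTrudgianII.lean` (T. S. Trudgian, *Improvements to Turing's method II*, Rocky
Mountain J. Math. 46 (2016) [Trudgian2016]).  That file proves the paper's Lemmas 1–2 and Theorem 2
and reduces the named fact `Literature.NumberTheory.LFunctions.abs_integral_zetaArgS_le_trudgianII`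
(`TuringMethod.lean`; [Trudgian2016, Thm 1]: `|∫_{t₁}^{t₂} S(t) dt| ≤ 1.698 + 0.183 log log t₂ +
0.049 log t₂` for `t₂ > t₁ > 10⁵`) to four inputs `H1`, `H2`, `hL`, `hnum`
(`Literature.NumberTheory.LFunctions.abs_integral_zetaArgS_le_trudgianII_of`).  Here two of them are
discharged and the other two are brought to their published shapes:

* `neg_setIntegral_Ioi_half_log_norm_riemannZeta_le_trudgianII` — **`hL` proved**: the lower bound
  `−∫_{1/2}^∞ log|ζ(σ+it)| dσ ≤ a₂ + (0.762²/2)(log 4 − 1) log t` for the non-ordinates `t > 10⁵`,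
  `a₂ = trudgianA₂ 0.762 10⁵`, from [Trudgian2011, Lemma 2.11] as proved in `TuringLowerBound.lean`
  (`Literature.NumberTheory.LFunctions.neg_setIntegral_Ioi_half_log_norm_riemannZeta_le'`) and
  Booker's Lemma 2.10, now the theorem
  `Literature.NumberTheory.LFunctions.Trudgian2011_lemma_2_10_holds` (`BookerLemmaProofs.lean`);
* `abs_integral_zetaArgS_le_trudgianII_of_Q10` — the reduction of `TuringMethodTrudgianII.lean` with
  the shift `Q₀ = 10` instead of `5` (free: `Q₀` enters `A₁` only through `(Q₀+1+δ)²/(2t₀²) < 10⁻⁸`,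
  and a larger shift makes the edge hypotheses elementary for `|u| < 3`);
* the certified numerics **`hnum` proved** (namespace `TrudgianIINumerics`, re-using the checker of
  `TuringMethodTrudgianNumerics.lean`: certified Euler–Maclaurin evaluations of `ζ(σ)` at scale `2^80`
  (`Literature.NumberTheory.LFunctions.ZetaNumerics.zetaBox`), trapezoid sums over increasing chains
  of certified nodes for the convex `log ζ(σ)`, the tail `∫_30^∞ log ζ ≤ 10⁻⁸`, the secant bound for
  `−ζ'/ζ`): `trudgianIICheck` (Boolean; the meshes of that file from the nodes `1.148`, `1.262`,
  `4.048` on — `209` nodes — two more nodes for the secant at `σ₀ = 1.262`, `h = 10⁻⁴`, and the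
  constants `log π`, `log 0.732`, `log ¾`), its soundness `bounds_of_trudgianIICheck`, and the
  arithmetic `trudgianII_A₂_le : a₂ ≤ 3.9588` (`−ζ'/ζ(1.262) ≤ 3.286141`,
  `−I(0.762) = ∫_{1.262}^{2.524} log ζ + ∫_{1.262}^{2.024} log ζ + ½∫_{4.048}^∞ log ζ ≤ 1.519723`),
  `trudgianII_A₁_le : A₁ ≤ 1.3377` (`∫_{1.148}^∞ log ζ ≤ 1.36127`, `log ζ(1.148) ≤ 1.99397107`),
  `trudgianII_numerics : A₁ + a₂ ≤ 1.698 π` (`5.2965 ≤ 5.3344`);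
* `norm_riemannZeta₁_half_line_le_of`, `trudgianII_H1_of_PT`, `trudgianII_H1_of_HPY`,
  `trudgianII_H2_of_TZ` — the edge hypotheses `H1` (`|ζ₁(½+iu)| ≤ 0.732|10.5+iu|^{7/6} log|10.5+iu|`)
  and `H2` (`|ζ₁(1+iu)| ≤ ¾|11+iu| log|11+iu|`), all real `u`, from the published statements:
  [PlattTrudgian2015, Cor. 2] (`|ζ(½+it)| ≤ 0.732|4.678+it|^{1/6} log|4.678+it|`, all `t`) or
  [HiaryPatelYang2024, Thm 1.1] (`|ζ(½+it)| ≤ 0.618 t^{1/6} log t`, `t ≥ 3`), and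
  [TrudgianZetaOne2014] (`|ζ(1+it)| ≤ ¾ log t`, `t ≥ 3`); small `|t|` by Titchmarsh (2.12.2)
  (`Literature.NumberTheory.LFunctions.norm_riemannZeta₁_le_of_re_pos`);
* `abs_integral_zetaArgS_le_trudgianII_of_check` — **Theorem 1 from `trudgianIICheck = true`, `H1`
  and `H2`**.  The evaluation `trudgianIICheck = true` (one `native_decide`, a `computational`
  proposal) is the separate file `TuringMethodTrudgianIINumericsCheck.lean`, which states the
  resulting reductions of the named fact to exactly the two explicit bounds.

## Status

What is NOT in the tree, and is all that separates the named fact from a theorem, is an explicit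
sub-convexity bound on the critical line with a constant `≤ 0.732` (Platt–Trudgian 2015 /
Hiary–Patel–Yang 2024: explicit van der Corput `A`/`B` processes plus Riemann–Siegel–Lehman for
moderate `t`) and `|ζ(1+it)| ≤ ¾ log t` for `t ≥ 3` (Trudgian 2014; cf. Patel, arXiv:2009.00769, for
the correction of the Kusmin–Landau constant these proofs used).  With Lehman's `2.53 t^{1/4}`
(`Literature.NumberTheory.LFunctions.Trudgian2011_lemma_2_5_allT_holds`) in place of `H1` the method
gives `c ≥ (1/16 + (d²/2)(log 4 − 1))/π`, and `c ≤ 0.049` then forces `d ≤ 0.688`, `a ≥ 1.77 > 1.698`: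
the printed constants genuinely require the `t^{1/6}` input.

## References

* T. S. Trudgian, *Improvements to Turing's method II*, Rocky Mountain J. Math. 46 (2016),
  325–332, Lemma 1, Cor. 1, Thms 1–2, Table 1.  [Trudgian2016]
* T. S. Trudgian, *Improvements to Turing's method*, Math. Comp. 80 (2011), 2259–2279, Lemma 2.11,
  §2.3.  [Trudgian2011]
* D. J. Platt, T. S. Trudgian, *An improved explicit bound on `|ζ(½+it)|`*, J. Number Theory 147
  (2015), 842–851, Cor. 2.  [PlattTrudgian2015]
* G. A. Hiary, D. Patel, A. Yang, *An improved explicit estimate for `ζ(1/2+it)`*, J. Number Theory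
  256 (2024), 195–217, Thm 1.1.  [HiaryPatelYang2024]
* T. S. Trudgian, *A new upper bound for `|ζ(1+it)|`*, Bull. Aust. Math. Soc. 89 (2014), 259–264.
  [TrudgianZetaOne2014]
* E. C. Titchmarsh, *The Theory of the Riemann Zeta-Function*, 2nd ed. (1986), (2.12.2).
-/

noncomputable section

open Complex Real Set MeasureTheory intervalIntegral Filter Topology

namespace Literature.NumberTheory.LFunctions

/-! ### The lower bound `hL`: Trudgian 2011, Lemma 2.11 at `d = 0.762`, `t > 10⁵`, now unconditional -/

/-- **The lower bound of [Trudgian 2016, proof of Thm 2]** ("Lemma 2.11 in [Trudgian 2011]" at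
`d = 0.762`): for `t > 10⁵` not an ordinate of a zero,
`−∫_{1/2}^∞ log|ζ(σ+it)| dσ ≤ a₂ + (0.762²/2)(log 4 − 1) log t` with
`a₂ = trudgianA₂ 0.762 10⁵` (`TuringLowerBound.lean`).  Unconditional: Booker's Lemma 2.10 is the
tree's theorem `Literature.NumberTheory.LFunctions.Trudgian2011_lemma_2_10_holds`.
[cite: Trudgian2016, Thm 2 (proof)] [cite: Trudgian2011, Lemma 2.11] -/
theorem neg_setIntegral_Ioi_half_log_norm_riemannZeta_le_trudgianII {t : ℝ}
    (ht : (10 : ℝ) ^ 5 < t) (hord : ∀ ρ : ℂ, riemannZeta ρ = 0 → ρ.im ≠ t) :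
    -(∫ x in Ioi (1 / 2 : ℝ), Real.log ‖riemannZeta (x + t * I)‖) ≤
      trudgianA₂ 0.762 ((10 : ℝ) ^ 5) + (0.762 ^ 2 / 2 * (Real.log 4 - 1)) * Real.log t := by
  have h := neg_setIntegral_Ioi_half_log_norm_riemannZeta_le' Trudgian2011_lemma_2_10_holds
    (d := 0.762) (t₀ := (10 : ℝ) ^ 5) (t := t) (by norm_num) (by norm_num) (by norm_num) ht hord
  simpa only [trudgianB₂] using h

/-! ### Theorem 1 from its inputs, with the shift `Q₀ = 10` -/

open MeasureTheory in
/-- **Trudgian 2016, Theorem 1 from its inputs, shift `Q₀ = 10`** (the row `T = 10¹⁰`,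
`d = 0.762`, `δ = 0.148` of Table 1, `(k₁, k₂, k₃, k₄, k₅) = (0.732, 1/6, 1, 3/4, 1)` as in (8),
but `Q₀ = 10` in place of `5`; the shift enters only through `(Q₀ + 1 + δ)²/(2t₀²) < 10⁻⁸`, and a
larger `Q₀` makes the edge hypotheses easier to verify for small `|u|`).  The named fact
`Literature.NumberTheory.LFunctions.abs_integral_zetaArgS_le_trudgianII` follows from
`H1`: `|ζ₁(½+iu)| ≤ 0.732 |10.5+iu|^{7/6} log|10.5+iu|`, `H2`: `|ζ₁(1+iu)| ≤ ¾ |11+iu| log|11+iu|`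
(all real `u`), the lower bound `hL` at `d = 0.762` with constant `a₂`, and the numerical
inequality `hnum` (`A₁ + a₂ ≤ 1.698π`).  Same proof as
`Literature.NumberTheory.LFunctions.abs_integral_zetaArgS_le_trudgianII_of`.
[cite: Trudgian2016, Thm 1, Thm 2, Table 1] -/
theorem abs_integral_zetaArgS_le_trudgianII_of_Q10
    (H1 : ∀ u : ℝ, ‖riemannZeta₁ (1 / 2 + u * I)‖ ≤
      0.732 * ‖(10 : ℂ) + (1 / 2 + u * I)‖ ^ (7 / 6 : ℝ) * Real.log ‖(10 : ℂ) + (1 / 2 + u * I)‖)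
    (H2 : ∀ u : ℝ, ‖riemannZeta₁ (1 + u * I)‖ ≤
      3 / 4 * ‖(10 : ℂ) + (1 + u * I)‖ * Real.log ‖(10 : ℂ) + (1 + u * I)‖)
    {a₂ : ℝ}
    (hL : ∀ t : ℝ, (10 : ℝ) ^ 5 < t → (∀ ρ : ℂ, riemannZeta ρ = 0 → ρ.im ≠ t) →
      -(∫ x in Ioi (1 / 2 : ℝ), Real.log ‖riemannZeta (x + t * I)‖) ≤
        a₂ + (0.762 ^ 2 / 2 * (Real.log 4 - 1)) * Real.log t)
    (hnum : (∫ σ in Ioi (1 + 0.148 : ℝ), Real.log ‖riemannZeta σ‖) + 1 / 4 * Real.log 0.732 +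
        (1 / 4 + 0.148 / 2) * Real.log (3 / 4) +
        0.148 / 2 * Real.log (riemannZeta ((1 + 0.148 : ℝ) : ℂ)).re +
        ((1 / 6 : ℝ) / 4 + 1 / 2 + 0.148) * ((10 + 1 + 0.148) ^ 2 / (2 * ((10 : ℝ) ^ 5) ^ 2)) +
        ((1 + 1) / 4 + 1 * 0.148 / 2) * ((10 + 1 + 0.148) ^ 2 / (2 * ((10 : ℝ) ^ 5) ^ 2) /
          Real.log ((10 : ℝ) ^ 5)) + a₂ ≤ 1.698 * π) :
    abs_integral_zetaArgS_le_trudgianII := by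
  intro t₁ t₂ h1 h12
  have hlog2 := Real.log_two_lt_d9
  have hlog2' := Real.log_two_gt_d9
  have hlog4 : Real.log 4 = 2 * Real.log 2 := by
    rw [show (4 : ℝ) = 2 ^ 2 by norm_num, Real.log_pow]; push_cast; ring
  have hc₂ : 0 ≤ 0.762 ^ 2 / 2 * (Real.log 4 - 1) := by
    have : 1 ≤ Real.log 4 := by rw [hlog4]; linarith
    have : (0 : ℝ) ≤ 0.762 ^ 2 / 2 := by norm_num
    positivity
  -- the edge hypotheses in the parametrised shape
  have H1' : ∀ u : ℝ, ‖riemannZeta₁ (1 / 2 + u * I)‖ ≤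
      0.732 * ‖((10 : ℝ) : ℂ) + (1 / 2 + u * I)‖ ^ ((1 / 6 : ℝ) + 1) *
        Real.log ‖((10 : ℝ) : ℂ) + (1 / 2 + u * I)‖ ^ (1 : ℝ) := by
    intro u
    rw [Real.rpow_one, show ((1 / 6 : ℝ) + 1) = 7 / 6 by norm_num]
    exact_mod_cast H1 u
  have H2' : ∀ u : ℝ, ‖riemannZeta₁ (1 + u * I)‖ ≤
      3 / 4 * ‖((10 : ℝ) : ℂ) + (1 + u * I)‖ * Real.log ‖((10 : ℝ) : ℂ) + (1 + u * I)‖ ^ (1 : ℝ) := by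
    intro u
    rw [Real.rpow_one]
    exact_mod_cast H2 u
  have hk : (1 : ℝ) - 1 ≤ 1 / 6 * Real.log (10 + 1 / 2) := by
    have : 0 ≤ Real.log (10 + 1 / 2) := Real.log_nonneg (by norm_num)
    linarith
  have hglue := abs_integral_zetaArgS_le_trudgianII_of_lower (k₁ := 0.732) (k₂ := 1 / 6) (k₃ := 1)
    (k₄ := 3 / 4) (k₅ := 1) (Q₀ := 10) (δ := 0.148) (t₀ := (10 : ℝ) ^ 5) (a₂ := a₂)
    (c₂ := 0.762 ^ 2 / 2 * (Real.log 4 - 1)) (by norm_num) (by norm_num) (by norm_num)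
    (by norm_num) (by norm_num) (by norm_num) (by norm_num) hk H1' H2' (by norm_num) hc₂ hL h1 h12.le
  refine hglue.trans ?_
  -- the three coefficient inequalities
  have hπ := Real.pi_gt_d6
  have hπ0 : 0 < π := Real.pi_pos
  have ht₂ : (10 : ℝ) ^ 5 < t₂ := h1.trans h12
  have hlogt₂ : 1 < Real.log t₂ := by
    have he : Real.exp 1 < t₂ := lt_trans (lt_trans Real.exp_one_lt_d9 (by norm_num)) ht₂
    have := Real.log_lt_log (Real.exp_pos 1) he
    rwa [Real.log_exp] at this
  have hlt : 0 ≤ Real.log t₂ := by linarith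
  have hll : 0 ≤ Real.log (Real.log t₂) := Real.log_nonneg hlogt₂.le
  have i1 : ((∫ σ in Ioi (1 + 0.148 : ℝ), Real.log ‖riemannZeta σ‖) + 1 / 4 * Real.log 0.732 +
        (1 / 4 + 0.148 / 2) * Real.log (3 / 4) +
        0.148 / 2 * Real.log (riemannZeta ((1 + 0.148 : ℝ) : ℂ)).re +
        ((1 / 6 : ℝ) / 4 + 1 / 2 + 0.148) * ((10 + 1 + 0.148) ^ 2 / (2 * ((10 : ℝ) ^ 5) ^ 2)) +
        ((1 + 1) / 4 + 1 * 0.148 / 2) * ((10 + 1 + 0.148) ^ 2 / (2 * ((10 : ℝ) ^ 5) ^ 2) /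
          Real.log ((10 : ℝ) ^ 5)) + a₂) / π ≤ 1.698 := by
    rw [div_le_iff₀ hπ0]; exact hnum
  have i2 : ((1 + 1) / 4 + 1 * 0.148 / 2) / π ≤ (0.183 : ℝ) := by
    rw [div_le_iff₀ hπ0]; nlinarith
  have i3 : (1 / 6 / 4 + 0.762 ^ 2 / 2 * (Real.log 4 - 1)) / π ≤ (0.049 : ℝ) := by
    rw [div_le_iff₀ hπ0, hlog4]; nlinarith
  nlinarith [mul_le_mul_of_nonneg_right i2 hll, mul_le_mul_of_nonneg_right i3 hlt]


/-! ### The certified numerics for `(δ, d) = (0.148, 0.762)`, `t₀ = 10⁵` -/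

namespace TrudgianIINumerics

open TrudgianNumerics
open Literature.Analysis.ValidatedNumerics.NumericsMP Literature.NumberTheory.LFunctions.ZetaNumerics

section Checker

/-- **Constant checks for Theorem 1**: `0.732 ≤ exp(−0.31197476)` and `3/4 ≤ exp(−0.28768207)`,
i.e. `log 0.732 ≤ −0.31197476`, `log(3/4) ≤ −0.28768207`. [folklore] -/
def checkConstsII (T : Tables) : Bool :=
  match expQ T (-3119747600), expQ T (-2876820700) with
  | some E1, some E2 =>
      decide ((MI.ofFrac T.S 732 1000).hi ≤ E1.lo) && decide ((MI.ofFrac T.S 3 4).hi ≤ E2.lo)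
  | _, _ => false

variable {T : Tables}

/-- **Soundness of the constant checks for Theorem 1.** [folklore] -/
theorem consts_of_checkConstsII (hT : T.Valid) (h : checkConstsII T = true) :
    Real.log ((732 : ℝ) / 1000) ≤ (-3119747600 : ℝ) / 10 ^ 10 ∧
      Real.log ((3 : ℝ) / 4) ≤ (-2876820700 : ℝ) / 10 ^ 10 := by
  unfold checkConstsII at h
  generalize h1 : expQ T (-3119747600) = o1 at h
  generalize h2 : expQ T (-2876820700) = o2 at h
  rcases o1 with _ | E1 <;> rcases o2 with _ | E2 <;> simp at h
  obtain ⟨c1, c2⟩ := h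
  have hS : (0 : ℝ) < T.S := by exact_mod_cast hT.S_pos
  have m1 := mem_expQ hT h1
  have m2 := mem_expQ hT h2
  have c1' : ((MI.ofFrac T.S 732 1000).hi : ℝ) ≤ E1.lo := by exact_mod_cast c1
  have c2' : ((MI.ofFrac T.S 3 4).hi : ℝ) ≤ E2.lo := by exact_mod_cast c2
  have m732 := MI.mem_ofFrac T.S (732 : ℤ) (q := 1000) (by norm_num)
  have m34 := MI.mem_ofFrac T.S (3 : ℤ) (q := 4) (by norm_num)
  refine ⟨?_, ?_⟩
  · rw [Real.log_le_iff_le_exp (by norm_num)]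
    refine le_of_mul_le_mul_right ?_ hS
    have := m732.2
    push_cast at m1 this ⊢
    linarith [m1.1]
  · rw [Real.log_le_iff_le_exp (by norm_num)]
    refine le_of_mul_le_mul_right ?_ hS
    have := m34.2
    push_cast at m2 this ⊢
    linarith [m2.1]

end Checker

/-! ### The data: four trapezoid meshes (re-using the nodes of `TuringMethodTrudgianNumerics.lean`) -/

section Data

/-- Mesh for `∫_{1.148}^{30} log ζ`: the nodes of `TrudgianNumerics.mesh1T` beyond `1.148` (first node
`(11480, 19939710646)`). [folklore] -/
def mesh1II : List (ℕ × ℤ) := TrudgianNumerics.mesh1T.drop 6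

/-- Mesh for `∫_{1.262}^{2.524} log ζ`: `TrudgianNumerics.mesh2T` and the node `2.524` (first node
`(12620, 14844978536)`). [folklore] -/
def mesh2II : List (ℕ × ℤ) := TrudgianNumerics.mesh2T ++ [(25240, 2869487823)]

/-- Mesh for `∫_{1.262}^{2.024} log ζ`: `TrudgianNumerics.mesh3T` and the node `2.024` (first node
`(12620, 14844978536)`). [folklore] -/
def mesh3II : List (ℕ × ℤ) := TrudgianNumerics.mesh3T ++ [(20240, 4842715576)]

/-- Claimed trapezoid bound `≥ ∫_{1.148}^{30} log ζ`. [folklore] -/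
def TB1II : ℚ := 13612699603 / 10 ^ 10
/-- Claimed trapezoid bound `≥ ∫_{1.262}^{2.524} log ζ`. [folklore] -/
def TB2II : ℚ := 8282487371 / 10 ^ 10
/-- Claimed trapezoid bound `≥ ∫_{1.262}^{2.024} log ζ`. [folklore] -/
def TB3II : ℚ := 6408243545 / 10 ^ 10
/-- Claimed trapezoid bound `≥ ∫_{4.048}^{30} log ζ`. [folklore] -/
def TB4II : ℚ := 1012996549 / 10 ^ 10

/-- **All checks for Theorem 1** with given tables: the four meshes from `1.148`, `1.262`, `1.262`,
`4.048` (certified nodes, increasing, right endpoints, trapezoid sums below the claimed bounds),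
the two nodes for the secant bound of `−ζ'/ζ(1.262)` (`log ζ(1.2619) ≤ 1.4848264670`,
`log ζ(1.262) ≥ 1.4844978529`), and the constants (`log π`, `log 0.732`, `log ¾`). [folklore] -/
def trudgianIICheckWith (T : Tables) : Bool :=
  checkNode T 11480 19939710646 true && checkNodes T mesh1II &&
  checkNode T 12620 14844978536 true && checkNodes T mesh2II && checkNodes T mesh3II &&
  checkNode T 40480 761172806 true && checkNodes T TrudgianNumerics.mesh4T &&
  checkNode T 12619 14848264670 true && checkNode T 12620 14844978529 false &&
  checkConsts T && checkConstsII T &&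
  sortedX 11480 mesh1II && sortedX 12620 mesh2II && sortedX 12620 mesh3II &&
  sortedX 40480 TrudgianNumerics.mesh4T &&
  decide (lastX 11480 mesh1II = 300000) && decide (lastX 12620 mesh2II = 25240) &&
  decide (lastX 12620 mesh3II = 20240) && decide (lastX 40480 TrudgianNumerics.mesh4T = 300000) &&
  decide (trapSumQ ((11480, 19939710646) :: mesh1II) ≤ TB1II) &&
  decide (trapSumQ ((12620, 14844978536) :: mesh2II) ≤ TB2II) &&
  decide (trapSumQ ((12620, 14844978536) :: mesh3II) ≤ TB3II) &&
  decide (trapSumQ ((40480, 761172806) :: TrudgianNumerics.mesh4T) ≤ TB4II)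

/-- **The certified computation for Theorem 1** (evaluated only by `native_decide`, in
`TuringMethodTrudgianIINumericsCheck.lean`; made irreducible below). [folklore] -/
def trudgianIICheck : Bool := (trudgianTables.map trudgianIICheckWith).getD false

end Data

/-! ### From the certified computation to the integrals and point values -/

section Assembly

/-- **What the certified computation proves** (soundness of `trudgianIICheck`): the four trapezoid
bounds, the three point values, and the constants. [folklore] -/
theorem bounds_of_trudgianIICheck (h : trudgianIICheck = true) :
    (∫ σ in ((11480 : ℕ) : ℝ) / 10 ^ 4..((300000 : ℕ) : ℝ) / 10 ^ 4, Real.log ‖riemannZeta σ‖) ≤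
        (TB1II : ℝ) ∧
    (∫ σ in ((12620 : ℕ) : ℝ) / 10 ^ 4..((25240 : ℕ) : ℝ) / 10 ^ 4, Real.log ‖riemannZeta σ‖) ≤
        (TB2II : ℝ) ∧
    (∫ σ in ((12620 : ℕ) : ℝ) / 10 ^ 4..((20240 : ℕ) : ℝ) / 10 ^ 4, Real.log ‖riemannZeta σ‖) ≤
        (TB3II : ℝ) ∧
    (∫ σ in ((40480 : ℕ) : ℝ) / 10 ^ 4..((300000 : ℕ) : ℝ) / 10 ^ 4, Real.log ‖riemannZeta σ‖) ≤
        (TB4II : ℝ) ∧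
    NodeOK (11480, 19939710646) ∧ NodeOK (12619, 14848264670) ∧
    ((14844978529 : ℤ) : ℝ) / 10 ^ 10 ≤
      Real.log ‖riemannZeta ((((12620 : ℕ) : ℝ) / 10 ^ 4 : ℝ) : ℂ)‖ ∧
    ((11447298858 : ℝ) / 10 ^ 10 ≤ Real.log π ∧ Real.log π ≤ (11447298860 : ℝ) / 10 ^ 10 ∧
      Real.log (253 / 100) ≤ (9282193028 : ℝ) / 10 ^ 10 ∧
      (51239639794 : ℝ) / 10 ^ 10 ≤ Real.log 168) ∧
    (Real.log ((732 : ℝ) / 1000) ≤ (-3119747600 : ℝ) / 10 ^ 10 ∧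
      Real.log ((3 : ℝ) / 4) ≤ (-2876820700 : ℝ) / 10 ^ 10) := by
  unfold trudgianIICheck at h
  generalize hT : trudgianTables = oT at h
  rcases oT with _ | T
  · simp at h
  have hTv : T.Valid := mkTables_valid hT
  simp only [Option.map_some, Option.getD_some, trudgianIICheckWith, Bool.and_eq_true,
    decide_eq_true_eq] at h
  obtain ⟨⟨⟨⟨⟨⟨⟨⟨⟨⟨⟨⟨⟨⟨⟨⟨⟨⟨⟨⟨⟨⟨n1, N1⟩, n2⟩, N2⟩, N3⟩, n4⟩, N4⟩, nZm⟩, nZ0⟩, hC⟩, hC2⟩, s1⟩,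
    s2⟩, s3⟩, s4⟩, l1⟩, l2⟩, l3⟩, l4⟩, t1⟩, t2⟩, t3⟩, t4⟩ := h
  have ok1 := nodeOK_of_checkNode hTv n1
  have ok2 := nodeOK_of_checkNode hTv n2
  have ok4 := nodeOK_of_checkNode hTv n4
  have okZm := nodeOK_of_checkNode hTv nZm
  have okZ0 := ge_of_checkNode hTv nZ0
  have L1 := nodeOK_of_checkNodes hTv N1
  have L2 := nodeOK_of_checkNodes hTv N2
  have L3 := nodeOK_of_checkNodes hTv N3
  have L4 := nodeOK_of_checkNodes hTv N4
  have cons : ∀ {p : ℕ × ℤ} {L : List (ℕ × ℤ)}, NodeOK p → (∀ q ∈ L, NodeOK q) →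
      ∀ q ∈ p :: L, NodeOK q := by
    intro p L hp hL q hq
    rcases List.mem_cons.1 hq with rfl | hq
    · exact hp
    · exact hL q hq
  have I1 := integral_le_trapSumQ mesh1II 11480 19939710646 s1 (cons ok1 L1)
  have I2 := integral_le_trapSumQ mesh2II 12620 14844978536 s2 (cons ok2 L2)
  have I3 := integral_le_trapSumQ mesh3II 12620 14844978536 s3 (cons ok2 L3)
  have I4 := integral_le_trapSumQ TrudgianNumerics.mesh4T 40480 761172806 s4 (cons ok4 L4)
  rw [l1] at I1; rw [l2] at I2; rw [l3] at I3; rw [l4] at I4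
  have t1' : ((trapSumQ ((11480, 19939710646) :: mesh1II) : ℚ) : ℝ) ≤ (TB1II : ℝ) := by
    exact_mod_cast t1
  have t2' : ((trapSumQ ((12620, 14844978536) :: mesh2II) : ℚ) : ℝ) ≤ (TB2II : ℝ) := by
    exact_mod_cast t2
  have t3' : ((trapSumQ ((12620, 14844978536) :: mesh3II) : ℚ) : ℝ) ≤ (TB3II : ℝ) := by
    exact_mod_cast t3
  have t4' : ((trapSumQ ((40480, 761172806) :: TrudgianNumerics.mesh4T) : ℚ) : ℝ) ≤ (TB4II : ℝ) := by
    exact_mod_cast t4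
  exact ⟨I1.trans t1', I2.trans t2', I3.trans t3', I4.trans t4', ok1, okZm, okZ0.2,
    consts_of_checkConsts hTv hC, consts_of_checkConstsII hTv hC2⟩

end Assembly

/-! ### The final arithmetic: `a₂ ≤ 3.9588`, `A₁ ≤ 1.3377`, `A₁ + a₂ ≤ 1.698 π` -/

section Arithmetic

/-- **`a₂(0.762, 10⁵) ≤ 3.9588`** from the certified `∫ log ζ` over `[1.262, 2.524]`, `[1.262, 2.024]`,
`[4.048, 30]`, the secant data at `1.262`, and `log π` (Trudgian 2016 works with the rounded
`−ζ'/ζ`, `∫ log ζ` of [Trudgian 2011, §2.3]; his `a₂` at `d = 0.762` is not printed).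
[cite: Trudgian2016, Thm 2 (proof) and Table 1] -/
theorem trudgianII_A₂_le
    (I2 : (∫ σ in (1.262 : ℝ)..2.524, Real.log ‖riemannZeta σ‖) ≤ 0.8282487371)
    (I3 : (∫ σ in (1.262 : ℝ)..2.024, Real.log ‖riemannZeta σ‖) ≤ 0.6408243545)
    (I4 : (∫ σ in (4.048 : ℝ)..30, Real.log ‖riemannZeta σ‖) ≤ 0.1012996549)
    (GZm : Real.log ‖riemannZeta (((1.262 - 1 / 10 ^ 4 : ℝ)) : ℂ)‖ ≤ 1.4848264670)
    (GZ0 : (1.4844978529 : ℝ) ≤ Real.log ‖riemannZeta (((1.262 : ℝ)) : ℂ)‖)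
    (Lπlo : (1.1447298858 : ℝ) ≤ Real.log π) (Lπhi : Real.log π ≤ (1.1447298860 : ℝ)) :
    trudgianA₂ 0.762 ((10 : ℝ) ^ 5) ≤ 3.9588 := by
  have r1 : (1 : ℝ) + 2 * 0.762 = 2.524 := by norm_num
  have r2 : (1 : ℝ) / 2 + 0.762 = 1.262 := by norm_num
  have r3 : (1 : ℝ) + 4 * 0.762 = 4.048 := by norm_num
  have r4 : (1 : ℝ) / 2 + 2 * 0.762 = 2.024 := by norm_num
  simp only [trudgianA₂, turingI, turingEps, turingEps', r1, r2, r3, r4]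
  -- the secant bound for `−ζ'/ζ(1.262)`
  have hZ : (-deriv riemannZeta ((1.262 : ℝ) : ℂ) / riemannZeta ((1.262 : ℝ) : ℂ)).re ≤
      3.286141 := by
    have hs := neg_re_logDeriv_riemannZeta_le_secant (σ₀ := 1.262) (h := 1 / 10 ^ 4)
      (by norm_num) (by norm_num)
    rw [neg_div, Complex.neg_re]
    have e : (Real.log ‖riemannZeta ((1.262 - 1 / 10 ^ 4 : ℝ) : ℂ)‖ -
        Real.log ‖riemannZeta ((1.262 : ℝ) : ℂ)‖) / (1 / 10 ^ 4) =
        10 ^ 4 * (Real.log ‖riemannZeta ((1.262 - 1 / 10 ^ 4 : ℝ) : ℂ)‖ -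
          Real.log ‖riemannZeta ((1.262 : ℝ) : ℂ)‖) := by ring
    rw [e] at hs
    linarith
  -- the error terms at `t₀ = 10⁵`
  have hπhi := Real.pi_lt_d6
  have hq1 : (4 : ℝ) / ((10 : ℝ) ^ 5) ^ 2 ≤ 0.0000000004 := by norm_num
  have hq2 : (3 : ℝ) / (2 * ((10 : ℝ) ^ 5) ^ 2) ≤ 0.0000000002 := by norm_num
  have hq3 : π / (4 * (10 : ℝ) ^ 5) ≤ 0.0000079 := by
    rw [div_le_iff₀ (by norm_num)]; linarith
  -- logs
  have hl2lo := Real.log_two_gt_d9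
  have hl2hi := Real.log_two_lt_d9
  obtain ⟨hl40, hl4⟩ := log_four_le
  -- `M₁`
  set Z := (-deriv riemannZeta ((1.262 : ℝ) : ℂ) / riemannZeta ((1.262 : ℝ) : ℂ)).re with hZdef
  have hM1 : Z - Real.log 2 / 2 - Real.log π / 2 +
      (4 / ((10 : ℝ) ^ 5) ^ 2 + π / (4 * (10 : ℝ) ^ 5)) ≤ 2.3672104 := by
    linarith
  have hT1 : (0.762 : ℝ) ^ 2 * Real.log 4 *
      (Z - Real.log 2 / 2 - Real.log π / 2 + (4 / ((10 : ℝ) ^ 5) ^ 2 + π / (4 * (10 : ℝ) ^ 5)))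
        ≤ 1.9054708 := by
    calc (0.762 : ℝ) ^ 2 * Real.log 4 *
        (Z - Real.log 2 / 2 - Real.log π / 2 + (4 / ((10 : ℝ) ^ 5) ^ 2 + π / (4 * (10 : ℝ) ^ 5)))
        ≤ (0.762 : ℝ) ^ 2 * Real.log 4 * 2.3672104 :=
          mul_le_mul_of_nonneg_left hM1 (by positivity)
      _ ≤ (0.762 : ℝ) ^ 2 * 1.3862943616 * 2.3672104 := by nlinarith
      _ ≤ 1.9054708 := by norm_num
  have hT2 : (0.762 : ℝ) ^ 2 * (Real.log 2 / 2 + Real.log π / 2 +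
      (3 / (2 * ((10 : ℝ) ^ 5) ^ 2) + π / (4 * (10 : ℝ) ^ 5))) ≤ 0.5335809 := by nlinarith
  -- the integrals: `−I(0.762) = ∫_{1.262}^{2.524} + ∫_{1.262}^{2.024} + ½ ∫_{4.048}^{∞}`
  have hI : IntegrableOn (fun σ : ℝ ↦ Real.log ‖riemannZeta σ‖) (Ioi 1.262) :=
    integrableOn_log_norm_riemannZeta_ofReal (by norm_num)
  have S2 := setIntegral_Ioi_eq_intervalIntegral_add (f := fun σ : ℝ ↦ Real.log ‖riemannZeta σ‖)
    (show (1.262 : ℝ) ≤ 2.524 by norm_num) hI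
  have S3 := setIntegral_Ioi_eq_intervalIntegral_add (f := fun σ : ℝ ↦ Real.log ‖riemannZeta σ‖)
    (show (2.524 : ℝ) ≤ 4.048 by norm_num) (hI.mono_set (Ioi_subset_Ioi (by norm_num)))
  have S4 := setIntegral_Ioi_eq_intervalIntegral_add (f := fun σ : ℝ ↦ Real.log ‖riemannZeta σ‖)
    (show (4.048 : ℝ) ≤ 30 by norm_num) (hI.mono_set (Ioi_subset_Ioi (by norm_num)))
  have htail := setIntegral_Ioi_log_norm_riemannZeta_tail_le (X := 30) (by norm_num)
  have htail' : 4 * (2 : ℝ) ^ (-(30 : ℝ)) / Real.log 2 ≤ 1 / 10 ^ 8 := by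
    rw [Real.rpow_neg (by norm_num), Real.rpow_ofNat, div_le_div_iff₀ (by linarith) (by norm_num)]
    norm_num; linarith
  rw [S2, S3, S4]
  nlinarith [hT1, hT2, I2, I3, I4, htail, htail', hZdef]

/-- **`A₁ ≤ 1.3377`** (the constant of [Trudgian 2016, Lemma 2] in the sharp form of
`Literature.NumberTheory.LFunctions.setIntegral_Ioi_half_log_norm_riemannZeta_le_trudgianII'`, at
`δ = 0.148`, `Q₀ = 10`, `t₀ = 10⁵`, without `a₂`) from the certified `∫_{1.148}^{30} log ζ`,
`log ζ(1.148)`, `log 0.732`, `log ¾`. [cite: Trudgian2016, (7) and Table 1] -/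
theorem trudgianII_A₁_le
    (I1 : (∫ σ in (1.148 : ℝ)..30, Real.log ‖riemannZeta σ‖) ≤ 1.3612699603)
    (G : Real.log ‖riemannZeta (((1.148 : ℝ)) : ℂ)‖ ≤ 1.9939710646)
    (L732 : Real.log 0.732 ≤ -0.31197476) (L75 : Real.log (3 / 4) ≤ -0.28768207) :
    (∫ σ in Ioi (1 + 0.148 : ℝ), Real.log ‖riemannZeta σ‖) + 1 / 4 * Real.log 0.732 +
        (1 / 4 + 0.148 / 2) * Real.log (3 / 4) +
        0.148 / 2 * Real.log (riemannZeta ((1 + 0.148 : ℝ) : ℂ)).re +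
        ((1 / 6 : ℝ) / 4 + 1 / 2 + 0.148) * ((10 + 1 + 0.148) ^ 2 / (2 * ((10 : ℝ) ^ 5) ^ 2)) +
        ((1 + 1) / 4 + 1 * 0.148 / 2) * ((10 + 1 + 0.148) ^ 2 / (2 * ((10 : ℝ) ^ 5) ^ 2) /
          Real.log ((10 : ℝ) ^ 5)) ≤ 1.3377 := by
  have r0 : (1 : ℝ) + 0.148 = 1.148 := by norm_num
  rw [r0]
  have hsplit := setIntegral_Ioi_eq_intervalIntegral_add (f := fun σ : ℝ ↦ Real.log ‖riemannZeta σ‖)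
    (show (1.148 : ℝ) ≤ 30 by norm_num) (integrableOn_log_norm_riemannZeta_ofReal (by norm_num))
  have htail := setIntegral_Ioi_log_norm_riemannZeta_tail_le (X := 30) (by norm_num)
  have hl2lo := Real.log_two_gt_d9
  have htail' : 4 * (2 : ℝ) ^ (-(30 : ℝ)) / Real.log 2 ≤ 1 / 10 ^ 8 := by
    rw [Real.rpow_neg (by norm_num), Real.rpow_ofNat, div_le_div_iff₀ (by linarith) (by norm_num)]
    norm_num; linarith
  have hσ : (1 : ℝ) < 1.148 := by norm_num
  have hre : Real.log (riemannZeta ((1.148 : ℝ) : ℂ)).re ≤ 1.9939710646 := by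
    rw [← norm_riemannZeta_ofReal_eq_re hσ]; exact G
  have htiny1 : ((1 / 6 : ℝ) / 4 + 1 / 2 + 0.148) * ((10 + 1 + 0.148) ^ 2 / (2 * ((10 : ℝ) ^ 5) ^ 2))
      ≤ 0.00000001 := by norm_num
  have hlog5 : 1 ≤ Real.log ((10 : ℝ) ^ 5) := by
    rw [← Real.log_exp 1]
    refine Real.log_le_log (Real.exp_pos 1) ?_
    have := Real.exp_one_lt_d9
    norm_num; linarith
  have htiny2 : ((1 + 1) / 4 + 1 * 0.148 / 2) * ((10 + 1 + 0.148) ^ 2 / (2 * ((10 : ℝ) ^ 5) ^ 2) /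
      Real.log ((10 : ℝ) ^ 5)) ≤ 0.00000001 := by
    have h0 : (10 + 1 + 0.148 : ℝ) ^ 2 / (2 * ((10 : ℝ) ^ 5) ^ 2) / Real.log ((10 : ℝ) ^ 5) ≤
        (10 + 1 + 0.148 : ℝ) ^ 2 / (2 * ((10 : ℝ) ^ 5) ^ 2) := div_le_self (by positivity) hlog5
    have h1 : (10 + 1 + 0.148 : ℝ) ^ 2 / (2 * ((10 : ℝ) ^ 5) ^ 2) ≤ 0.00000001 := by norm_num
    nlinarith
  rw [hsplit]
  linarith

/-- **Trudgian 2016, Theorem 1, the numerical part**: `A₁ + a₂ ≤ 1.698 π` for the row `T = 10¹⁰`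
of Table 1 (`δ = 0.148`, `d = 0.762`; here `Q₀ = 10`, `t₀ = 10⁵`, `a₂ = trudgianA₂ 0.762 10⁵`),
granted the certified computation `trudgianIICheck = true` (indeed `A₁ + a₂ ≤ 5.2965 < 5.3344`;
the paper's `a = 1.698` is `(A₁ + a₂)/π` with its own `A₁ ≈ 1.38`).
[cite: Trudgian2016, Thm 1 and Table 1] -/
theorem trudgianII_numerics (h : trudgianIICheck = true) :
    (∫ σ in Ioi (1 + 0.148 : ℝ), Real.log ‖riemannZeta σ‖) + 1 / 4 * Real.log 0.732 +
        (1 / 4 + 0.148 / 2) * Real.log (3 / 4) +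
        0.148 / 2 * Real.log (riemannZeta ((1 + 0.148 : ℝ) : ℂ)).re +
        ((1 / 6 : ℝ) / 4 + 1 / 2 + 0.148) * ((10 + 1 + 0.148) ^ 2 / (2 * ((10 : ℝ) ^ 5) ^ 2)) +
        ((1 + 1) / 4 + 1 * 0.148 / 2) * ((10 + 1 + 0.148) ^ 2 / (2 * ((10 : ℝ) ^ 5) ^ 2) /
          Real.log ((10 : ℝ) ^ 5)) + trudgianA₂ 0.762 ((10 : ℝ) ^ 5) ≤ 1.698 * π := by
  obtain ⟨I1, I2, I3, I4, ok1, okZm, okZ0, ⟨Lπlo, Lπhi, -, -⟩, L732, L75⟩ :=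
    bounds_of_trudgianIICheck h
  have e1 : ((11480 : ℕ) : ℝ) / 10 ^ 4 = 1.148 := by norm_num
  have e2 : ((300000 : ℕ) : ℝ) / 10 ^ 4 = 30 := by norm_num
  have e3 : ((12620 : ℕ) : ℝ) / 10 ^ 4 = 1.262 := by norm_num
  have e4 : ((25240 : ℕ) : ℝ) / 10 ^ 4 = 2.524 := by norm_num
  have e5 : ((20240 : ℕ) : ℝ) / 10 ^ 4 = 2.024 := by norm_num
  have e6 : ((40480 : ℕ) : ℝ) / 10 ^ 4 = 4.048 := by norm_num
  have e7 : ((12619 : ℕ) : ℝ) / 10 ^ 4 = 1.262 - 1 / 10 ^ 4 := by norm_num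
  rw [e1, e2] at I1; rw [e3, e4] at I2; rw [e3, e5] at I3; rw [e6, e2] at I4
  have G : Real.log ‖riemannZeta (((1.148 : ℝ)) : ℂ)‖ ≤ 1.9939710646 := by
    have := ok1.2; simp only at this; rw [e1] at this
    refine this.trans ?_; norm_num
  have GZm : Real.log ‖riemannZeta (((1.262 - 1 / 10 ^ 4 : ℝ)) : ℂ)‖ ≤ 1.4848264670 := by
    have := okZm.2; simp only at this; rw [e7] at this
    refine this.trans ?_; norm_num
  have GZ0 : (1.4844978529 : ℝ) ≤ Real.log ‖riemannZeta (((1.262 : ℝ)) : ℂ)‖ := by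
    rw [e3] at okZ0; refine le_trans ?_ okZ0; norm_num
  have hTB1 : ((TB1II : ℚ) : ℝ) = 1.3612699603 := by norm_num [TB1II]
  have hTB2 : ((TB2II : ℚ) : ℝ) = 0.8282487371 := by norm_num [TB2II]
  have hTB3 : ((TB3II : ℚ) : ℝ) = 0.6408243545 := by norm_num [TB3II]
  have hTB4 : ((TB4II : ℚ) : ℝ) = 0.1012996549 := by norm_num [TB4II]
  rw [hTB1] at I1; rw [hTB2] at I2; rw [hTB3] at I3; rw [hTB4] at I4
  have hA1 := trudgianII_A₁_le I1 G (by norm_num at L732 ⊢; exact L732)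
    (by norm_num at L75 ⊢; exact L75)
  have hA2 := trudgianII_A₂_le I2 I3 I4 GZm GZ0 (by norm_num at Lπlo ⊢; exact Lπlo)
    (by norm_num at Lπhi ⊢; exact Lπhi)
  have hπ := Real.pi_gt_d6
  linarith

end Arithmetic

end TrudgianIINumerics


/-! ### The edge hypotheses from the published bounds (`Q₀ = 10`) -/

/-- **`H1` from a critical-line bound for `t ≥ T` plus a bound for `|t| < T`.**  If
`|ζ(½+it)| ≤ k₁ t^{k₂} (log t)^{k₃}` for `t ≥ T ≥ 1` (Hiary–Patel–Yang: `k₁ = 0.618`, `k₂ = 1/6`,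
`k₃ = 1`, `T = 3`) and `|ζ₁(½+iu)| ≤ k₁ (Q₀+½)^{k₂+1} (log(Q₀+½))^{k₃}` for `|u| < T` (`Q₀ ≥ ½`), then
`|ζ₁(½+iu)| ≤ k₁ |Q₀+½+iu|^{k₂+1} (log|Q₀+½+iu|)^{k₃}` for all real `u` — the first edge hypothesis
of [Trudgian2016, Lemma 1] (negative `u` by `ζ(s̄) = conj ζ(s)`; `|s−1|, |u| ≤ |Q₀+½+iu|`).
[cite: Trudgian2016, Lemma 1 and Cor. 1 (proof)] -/
theorem norm_riemannZeta₁_half_line_le_of {k₁ k₂ k₃ Q₀ T : ℝ} (hk₁ : 0 ≤ k₁) (hk₂ : 0 ≤ k₂)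
    (hk₃ : 0 ≤ k₃) (hQ₀ : 1 / 2 ≤ Q₀) (hT : 1 ≤ T)
    (hlarge : ∀ t : ℝ, T ≤ t → ‖riemannZeta (1 / 2 + t * I)‖ ≤ k₁ * t ^ k₂ * Real.log t ^ k₃)
    (hsmall : ∀ u : ℝ, |u| < T →
      ‖riemannZeta₁ (1 / 2 + u * I)‖ ≤ k₁ * (Q₀ + 1 / 2) ^ (k₂ + 1) * Real.log (Q₀ + 1 / 2) ^ k₃)
    (u : ℝ) :
    ‖riemannZeta₁ (1 / 2 + u * I)‖ ≤
      k₁ * ‖(Q₀ : ℂ) + (1 / 2 + u * I)‖ ^ (k₂ + 1) * Real.log ‖(Q₀ : ℂ) + (1 / 2 + u * I)‖ ^ k₃ := by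
  set s : ℂ := 1 / 2 + u * I with hs
  set N : ℝ := ‖(Q₀ : ℂ) + s‖ with hN
  have e2 : (Q₀ : ℂ) + s = ((Q₀ + 1 / 2 : ℝ) : ℂ) + u * I := by simp [hs]; ring
  have hNre : Q₀ + 1 / 2 ≤ N := by
    rw [hN, e2]
    refine le_trans ?_ (abs_re_le_norm _)
    simp only [add_re, ofReal_re, mul_re, I_re, I_im, ofReal_im, mul_zero, mul_one, sub_self,
      add_zero]
    exact le_abs_self _
  have hNu : |u| ≤ N := by
    rw [hN, e2]
    refine le_trans ?_ (abs_im_le_norm _)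
    simp
  have hN1 : 1 ≤ N := by linarith
  have hN0 : 0 < N := by linarith
  have hlogN0 : 0 ≤ Real.log N := Real.log_nonneg hN1
  rcases lt_or_ge |u| T with hu | hu
  · -- small `|u|`
    have hl : Real.log (Q₀ + 1 / 2) ≤ Real.log N := Real.log_le_log (by linarith) hNre
    have hl0 : 0 ≤ Real.log (Q₀ + 1 / 2) := Real.log_nonneg (by linarith)
    have hp : (Q₀ + 1 / 2) ^ (k₂ + 1) ≤ N ^ (k₂ + 1) :=
      Real.rpow_le_rpow (by linarith) hNre (by linarith)
    have hlk : Real.log (Q₀ + 1 / 2) ^ k₃ ≤ Real.log N ^ k₃ := Real.rpow_le_rpow hl0 hl hk₃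
    calc ‖riemannZeta₁ s‖ ≤ k₁ * (Q₀ + 1 / 2) ^ (k₂ + 1) * Real.log (Q₀ + 1 / 2) ^ k₃ := hsmall u hu
      _ ≤ k₁ * N ^ (k₂ + 1) * Real.log N ^ k₃ := by
          apply mul_le_mul (mul_le_mul_of_nonneg_left hp hk₁) hlk (by positivity) (by positivity)
  · -- `|u| ≥ T ≥ 1`: reduce to `u > 0` by conjugation
    have hu1 : 1 ≤ |u| := hT.trans hu
    have hs1 : s ≠ 1 := fun h' ↦ by
      have := congrArg Complex.re h'; norm_num [hs] at this
    have hζ : ‖riemannZeta s‖ ≤ k₁ * |u| ^ k₂ * Real.log |u| ^ k₃ := by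
      rcases le_or_gt 0 u with hu0 | hu0
      · have := hlarge u (by rwa [abs_of_nonneg hu0] at hu)
        rwa [abs_of_nonneg hu0]
      · have h' := hlarge (-u) (by rwa [abs_of_neg hu0] at hu)
        have hc : (1 / 2 + ((-u : ℝ) : ℂ) * I) = starRingEnd ℂ s := by
          apply Complex.ext <;> simp [hs]
        rw [hc, riemannZeta_conj, Complex.norm_conj] at h'
        rwa [abs_of_neg hu0]
    have hsm1 : ‖s - 1‖ ≤ N := by
      have e1 : s - 1 = ((-(1 / 2) : ℝ) : ℂ) + u * I := by simp [hs]; ring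
      rw [e1, hN, e2, Complex.norm_add_mul_I, Complex.norm_add_mul_I]
      exact Real.sqrt_le_sqrt (by nlinarith)
    have hupow : |u| ^ k₂ ≤ N ^ k₂ := Real.rpow_le_rpow (abs_nonneg u) hNu hk₂
    have hlogu0 : 0 ≤ Real.log |u| := Real.log_nonneg hu1
    have hlogu : Real.log |u| ≤ Real.log N := Real.log_le_log (by linarith) hNu
    have hlk : Real.log |u| ^ k₃ ≤ Real.log N ^ k₃ := Real.rpow_le_rpow hlogu0 hlogu hk₃
    rw [LFunctions.riemannZeta₁_eq_mul hs1, norm_mul, Real.rpow_add hN0, Real.rpow_one]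
    calc ‖s - 1‖ * ‖riemannZeta s‖ ≤ N * (k₁ * |u| ^ k₂ * Real.log |u| ^ k₃) :=
          mul_le_mul hsm1 hζ (norm_nonneg _) hN0.le
      _ ≤ N * (k₁ * N ^ k₂ * Real.log N ^ k₃) := by
          apply mul_le_mul_of_nonneg_left _ hN0.le
          exact mul_le_mul (mul_le_mul_of_nonneg_left hupow hk₁) hlk (by positivity) (by positivity)
      _ = k₁ * (N ^ k₂ * N) * Real.log N ^ k₃ := by ring

/-- **`H1` (with `Q₀ = 10`) from the Platt–Trudgian bound** `|ζ(½+it)| ≤ 0.732 |4.678+it|^{1/6}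
log|4.678+it|` for all real `t` ([PlattTrudgian2015, Cor. 2], as quoted in [Trudgian2016, proof of
Cor. 1]). [cite: Trudgian2016, Cor. 1 (proof)] -/
theorem trudgianII_H1_of_PT
    (hPT : ∀ t : ℝ, ‖riemannZeta (1 / 2 + t * I)‖ ≤
      0.732 * ‖((4.678 : ℝ) : ℂ) + t * I‖ ^ (1 / 6 : ℝ) * Real.log ‖((4.678 : ℝ) : ℂ) + t * I‖)
    (u : ℝ) :
    ‖riemannZeta₁ (1 / 2 + u * I)‖ ≤
      0.732 * ‖(10 : ℂ) + (1 / 2 + u * I)‖ ^ (7 / 6 : ℝ) * Real.log ‖(10 : ℂ) + (1 / 2 + u * I)‖ := by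
  have h := norm_riemannZeta₁_half_line_le_of_shifted (k₁ := 0.732) (k₂ := 1 / 6) (k₃ := 1)
    (Q := 4.678) (Q₀ := 10) (by norm_num) (by norm_num) (by norm_num) (by norm_num) (by norm_num)
    (fun t ↦ by rw [Real.rpow_one]; exact hPT t) u
  rw [Real.rpow_one, show ((1 / 6 : ℝ) + 1) = 7 / 6 by norm_num] at h
  exact_mod_cast h

/-- **`H1` (with `Q₀ = 10`) from a Hiary–Patel–Yang-type bound** `|ζ(½+it)| ≤ 0.618 t^{1/6} log t`
for `t ≥ 3` ([HiaryPatelYang2024, Thm 1.1]); for `|t| < 3`, `|ζ₁(½+it)| ≤ |s| + 2|s||s−1| ≤ 21.7`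
(Titchmarsh (2.12.2), `Literature.NumberTheory.LFunctions.norm_riemannZeta₁_le_of_re_pos`)
`≤ 0.732 · 10.5^{7/6} · log 10.5`. [cite: Trudgian2016, Lemma 1 and Cor. 1 (proof)] -/
theorem trudgianII_H1_of_HPY
    (hHPY : ∀ t : ℝ, 3 ≤ t → ‖riemannZeta (1 / 2 + t * I)‖ ≤ 0.618 * t ^ (1 / 6 : ℝ) * Real.log t)
    (u : ℝ) :
    ‖riemannZeta₁ (1 / 2 + u * I)‖ ≤
      0.732 * ‖(10 : ℂ) + (1 / 2 + u * I)‖ ^ (7 / 6 : ℝ) * Real.log ‖(10 : ℂ) + (1 / 2 + u * I)‖ := by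
  have h := norm_riemannZeta₁_half_line_le_of (k₁ := 0.732) (k₂ := 1 / 6) (k₃ := 1) (Q₀ := 10)
    (T := 3) (by norm_num) (by norm_num) (by norm_num) (by norm_num) (by norm_num)
    (fun t ht ↦ by
      rw [Real.rpow_one]
      have h0 : 0 ≤ t ^ (1 / 6 : ℝ) * Real.log t :=
        mul_nonneg (Real.rpow_nonneg (by linarith)  _) (Real.log_nonneg (by linarith))
      calc ‖riemannZeta (1 / 2 + t * I)‖ ≤ 0.618 * t ^ (1 / 6 : ℝ) * Real.log t := hHPY t ht
        _ = 0.618 * (t ^ (1 / 6 : ℝ) * Real.log t) := by ring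
        _ ≤ 0.732 * (t ^ (1 / 6 : ℝ) * Real.log t) := by nlinarith
        _ = 0.732 * t ^ (1 / 6 : ℝ) * Real.log t := by ring)
    (fun u hu ↦ by
      rw [Real.rpow_one]
      have hre : (1 / 2 + u * I : ℂ).re = 1 / 2 := by simp
      have hs : (0 : ℝ) < (1 / 2 + u * I : ℂ).re := by rw [hre]; norm_num
      have hb := norm_riemannZeta₁_le_of_re_pos hs
      rw [hre] at hb
      have hu2 : u ^ 2 < 9 := by
        have := abs_lt.1 hu; nlinarith
      have hn : ‖(1 / 2 + u * I : ℂ)‖ ≤ 3.05 := by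
        have e : (1 / 2 + u * I : ℂ) = ((1 / 2 : ℝ) : ℂ) + u * I := by push_cast; ring
        rw [e, Complex.norm_add_mul_I, Real.sqrt_le_iff]
        constructor
        · norm_num
        · nlinarith
      have hn1 : ‖(1 / 2 + u * I : ℂ) - 1‖ ≤ 3.05 := by
        have e : (1 / 2 + u * I : ℂ) - 1 = ((-(1 / 2) : ℝ) : ℂ) + u * I := by push_cast; ring
        rw [e, Complex.norm_add_mul_I, Real.sqrt_le_iff]
        constructor
        · norm_num
        · nlinarith
      have hpow : (15.4 : ℝ) ≤ (10 + 1 / 2) ^ ((1 / 6 : ℝ) + 1) := by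
        rw [Real.rpow_add (by norm_num), Real.rpow_one]
        have h6 : (1.467 : ℝ) ≤ (10 + 1 / 2) ^ (1 / 6 : ℝ) := by
          have e : (1.467 : ℝ) = ((1.467 : ℝ) ^ (6 : ℝ)) ^ (1 / 6 : ℝ) := by
            rw [← Real.rpow_mul (by norm_num)]; norm_num
          rw [e]
          exact Real.rpow_le_rpow (by positivity) (by norm_num) (by norm_num)
        nlinarith
      have hlog : (2 : ℝ) ≤ Real.log (10 + 1 / 2) := by
        rw [Real.le_log_iff_exp_le (by norm_num)]
        have h1 := Real.exp_one_lt_d9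
        have h2 : Real.exp 2 = Real.exp 1 ^ 2 := by
          rw [← Real.exp_nat_mul]; norm_num
        rw [h2]
        nlinarith [Real.exp_pos 1]
      calc ‖riemannZeta₁ (1 / 2 + u * I)‖
          ≤ ‖(1 / 2 + u * I : ℂ)‖ + ‖(1 / 2 + u * I : ℂ)‖ * ‖(1 / 2 + u * I : ℂ) - 1‖ / (1 / 2) := hb
        _ ≤ 3.05 + 3.05 * 3.05 / (1 / 2) := by gcongr
        _ ≤ 0.732 * 15.4 * 2 := by norm_num
        _ ≤ 0.732 * (10 + 1 / 2) ^ ((1 / 6 : ℝ) + 1) * Real.log (10 + 1 / 2) := by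
            apply mul_le_mul (mul_le_mul_of_nonneg_left hpow (by norm_num)) hlog (by norm_num)
            positivity)
    u
  rw [Real.rpow_one, show ((1 / 6 : ℝ) + 1) = 7 / 6 by norm_num] at h
  exact_mod_cast h

/-- **`H2` (with `Q₀ = 10`) from Trudgian's bound** `|ζ(1+it)| ≤ ¾ log t` for `t ≥ 3`
([TrudgianZetaOne2014], as quoted in [Trudgian2016, proof of Cor. 1]); for `|t| < 3`,
`|ζ₁(1+it)| ≤ |s|(1 + |s−1|) ≤ 16` (Titchmarsh (2.12.2)) `≤ ¾ · 11 · log 11`.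
[cite: Trudgian2016, Cor. 1 (proof)] -/
theorem trudgianII_H2_of_TZ
    (hTZ : ∀ t : ℝ, 3 ≤ t → ‖riemannZeta (1 + t * I)‖ ≤ 3 / 4 * Real.log t) (u : ℝ) :
    ‖riemannZeta₁ (1 + u * I)‖ ≤
      3 / 4 * ‖(10 : ℂ) + (1 + u * I)‖ * Real.log ‖(10 : ℂ) + (1 + u * I)‖ := by
  have h := norm_riemannZeta₁_one_line_le_of (k₄ := 3 / 4) (k₅ := 1) (Q₀ := 10) (T := 3)
    (by norm_num) (by norm_num) (by norm_num) (by norm_num)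
    (fun t ht ↦ by rw [Real.rpow_one]; exact hTZ t ht)
    (fun u hu ↦ by
      rw [Real.rpow_one]
      have hre : (1 + u * I : ℂ).re = 1 := by simp
      have hs : (0 : ℝ) < (1 + u * I : ℂ).re := by rw [hre]; norm_num
      have hb := norm_riemannZeta₁_le_of_re_pos hs
      rw [hre, div_one] at hb
      have hn1 : ‖(1 + u * I : ℂ) - 1‖ = |u| := by
        have e : (1 + u * I : ℂ) - 1 = u * I := by ring
        rw [e, norm_mul, Complex.norm_I, mul_one, Complex.norm_real, Real.norm_eq_abs]
      have hn : ‖(1 + u * I : ℂ)‖ ≤ 1 + |u| := by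
        calc ‖(1 + u * I : ℂ)‖ ≤ ‖(1 : ℂ)‖ + ‖(u : ℂ) * I‖ := norm_add_le _ _
          _ = 1 + |u| := by
              rw [norm_one, norm_mul, Complex.norm_I, mul_one, Complex.norm_real, Real.norm_eq_abs]
      have hlog : (2 : ℝ) ≤ Real.log (10 + 1) := by
        rw [Real.le_log_iff_exp_le (by norm_num)]
        have h1 := Real.exp_one_lt_d9
        have h2 : Real.exp 2 = Real.exp 1 ^ 2 := by
          rw [← Real.exp_nat_mul]; norm_num
        rw [h2]
        nlinarith [Real.exp_pos 1]
      have hu0 := abs_nonneg u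
      calc ‖riemannZeta₁ (1 + u * I)‖
          ≤ ‖(1 + u * I : ℂ)‖ + ‖(1 + u * I : ℂ)‖ * ‖(1 + u * I : ℂ) - 1‖ := hb
        _ ≤ (1 + |u|) + (1 + |u|) * |u| := by rw [hn1]; gcongr
        _ ≤ 16 := by nlinarith
        _ ≤ 3 / 4 * (10 + 1) * 2 := by norm_num
        _ ≤ 3 / 4 * (10 + 1) * Real.log (10 + 1) := by
            apply mul_le_mul_of_nonneg_left hlog; norm_num)
    u
  rw [Real.rpow_one] at h
  exact_mod_cast h

/-! ### Theorem 1 from the two explicit edge bounds and the certified computation -/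

open TrudgianIINumerics in
/-- **Trudgian 2016, Theorem 1, conditional form.**  Granted the certified computation
`trudgianIICheck = true` (evaluated by `native_decide` in `TuringMethodTrudgianIINumericsCheck.lean`),
the two edge bounds of [Trudgian2016, Lemma 1] with `(k₁,…,k₅) = (0.732, 1/6, 1, ¾, 1)` and
`Q₀ = 10` — `H1`: `|ζ₁(½+iu)| ≤ 0.732 |10.5+iu|^{7/6} log|10.5+iu|` (from [PlattTrudgian2015]) and
`H2`: `|ζ₁(1+iu)| ≤ ¾ |11+iu| log|11+iu|` (from [TrudgianZetaOne2014]), all real `u` — imply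
`|∫_{t₁}^{t₂} S(t) dt| ≤ 1.698 + 0.183 log log t₂ + 0.049 log t₂` for `t₂ > t₁ > 10⁵`
(`Literature.NumberTheory.LFunctions.abs_integral_zetaArgS_le_trudgianII`).  Turing's lemma, the
Phragmén–Lindelöf step, the Hadamard-product lower bound with Booker's `log 4`, and the numerics
are all proved in the tree. [cite: Trudgian2016, Thm 1] -/
theorem abs_integral_zetaArgS_le_trudgianII_of_check
    (hcheck : TrudgianIINumerics.trudgianIICheck = true)
    (H1 : ∀ u : ℝ, ‖riemannZeta₁ (1 / 2 + u * I)‖ ≤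
      0.732 * ‖(10 : ℂ) + (1 / 2 + u * I)‖ ^ (7 / 6 : ℝ) * Real.log ‖(10 : ℂ) + (1 / 2 + u * I)‖)
    (H2 : ∀ u : ℝ, ‖riemannZeta₁ (1 + u * I)‖ ≤
      3 / 4 * ‖(10 : ℂ) + (1 + u * I)‖ * Real.log ‖(10 : ℂ) + (1 + u * I)‖) :
    abs_integral_zetaArgS_le_trudgianII :=
  abs_integral_zetaArgS_le_trudgianII_of_Q10 H1 H2 (a₂ := trudgianA₂ 0.762 ((10 : ℝ) ^ 5))
    (fun _ ht hord ↦ neg_setIntegral_Ioi_half_log_norm_riemannZeta_le_trudgianII ht hord)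
    (trudgianII_numerics hcheck)

/-! The check is evaluated only by `native_decide` (file `TuringMethodTrudgianIINumericsCheck.lean`);
make it opaque to the elaborator so that stating `trudgianIICheck = true` never unfolds it. -/
attribute [irreducible] TrudgianIINumerics.trudgianIICheck

end Literature.NumberTheory.LFunctions

end
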